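import Summits.SmoothPoincare4.SmoothPoincare4.Theses.ZeroSurgeryExotic
import Literature.Uncategorized.Crux
import Literature.Topology.FourManifolds.Rasmussen
import HarnessLib

/-!
# `ZseThesis` is derived from the sibling crux `ZseCruxRasmussen` and Rasmussen's Theorem 1

Route `SmoothPoincare4/ZeroSurgeryExotic`, item stmt-SmoothPoincare4-0364 (`ZseThesis`, the route's target:
some smoothly slice knot has a non-slice `0`-friend). This file records, as a Theorems-level CONDITIONAL result, the
derivation that the route file cannot carry (its import cone deliberately excludes `LeeRasmussen`): the target follows
from

* the registered open statement `Literature.Uncategorized.Crux` — the gate's verbatim transcription of route item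
  stmt-SmoothPoincare4-0366 (`ZseCruxRasmussen`: a `0`-surgery pair with `K` smoothly slice and `s(K') ≠ 0`), and
* Rasmussen's Theorem 1 in the slice case, the tree's named fact
  `Literature.Topology.FourManifolds.eq_zero_of_isSmoothlySlice` (`s = 0` on smoothly slice knots; NOT yet discharged —
  the tree reduces it to filtered Lee maps of link-diagram cobordisms, `eq_zero_of_isSmoothlySlice_of_filtered`).

So 0364 = {a witness of 0366} + {Rasmussen 2010 Thm 1}: every line of the sibling crux is a line of the target, and the
only content of the target beyond 0366 that the tree can express today is the named fact (the refined witness tiers —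
LEO `s̃_c`, `s^{Sq²}`, `sl₃` — have no predicate in the tree yet). The same two-line argument appears in the crux work
file `Cruxes/ZseThesis/Disproof.lean` (`zseThesis_of_crux`) and in the registered line skeleton `Cruxes/ZseThesis/Lines/
Sketch.lean` (`exists_pair_not_isSmoothlySlice_of_crux`); here it is landed where the route's bookkeeping can see it.

References: J. Rasmussen, *Khovanov homology and the slice genus*, Invent. Math. 182 (2010), Thm. 1;
C. Manolescu, L. Piccirillo, *From zero surgeries to candidates for exotic definite four-manifolds* (2023), §1.
-/

noncomputable section

-- the prescribed namespace `Summit.<P>.<Sub>.…` duplicates `SmoothPoincare4` (P = Sub)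
set_option linter.dupNamespace false

open scoped Manifold ContDiff
open Literature.Topology.FourManifolds Literature.Uncategorized

namespace Summit.SmoothPoincare4.SmoothPoincare4.Theorems

/-- **The target from the `s`-witness crux, mod Rasmussen's Theorem 1.** If some `0`-surgery pair `(K, K', Y)` has
`K` smoothly slice and `K'.HasRasmussenInvariant s` with `s ≠ 0` (`Literature.Uncategorized.Crux`, item 0366), and
smoothly slice knots have `s = 0` (`eq_zero_of_isSmoothlySlice`, Rasmussen 2010 Thm 1), then `K'` is not smoothly
slice, so `(K, K', Y)` witnesses `ZseThesis` (item 0364). CONDITIONAL on both hypotheses: the first is an OPEN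
statement (a proof disproves `SmoothPoincare4`), the second an undischarged named fact. [cite: Rasmussen2010, Thm. 1] -/
theorem zseThesis_of_crux_of_eq_zero_of_isSmoothlySlice (hR : eq_zero_of_isSmoothlySlice) (hc : Crux) :
    Theses.ZeroSurgeryExotic.ZseThesis := by
  obtain ⟨K, K', Y, _, _, s, h1, h2, h3, h4, h5⟩ := hc
  exact ⟨K, K', Y, _, _, h1, h2, h3, fun hs ↦ h5 (hR h4 hs)⟩

/-- Contrapositive bookkeeping: mod Rasmussen's Theorem 1, a refutation of the target (= the route's kill switch
`Assembly2`, "the `0`-surgery type determines smooth sliceness") refutes the `s`-witness crux 0366 as well, i.e. proves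
the kill test `Literature.Uncategorized.SVanishesOnPairs` (item 0368). [cite: Rasmussen2010, Thm. 1] -/
theorem sVanishesOnPairs_of_not_zseThesis_of_eq_zero_of_isSmoothlySlice (hR : eq_zero_of_isSmoothlySlice)
    (h : ¬ Theses.ZeroSurgeryExotic.ZseThesis) : SVanishesOnPairs :=
  not_crux_iff_sVanishesOnPairs.1 fun hc ↦ h (zseThesis_of_crux_of_eq_zero_of_isSmoothlySlice hR hc)

end Summit.SmoothPoincare4.SmoothPoincare4.Theorems

end
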